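import Summits.BirchSwinnertonDyer.BirchSwinnertonDyer.Theses.SemiOrdinaryEisensteinDescent
import Summits.BirchSwinnertonDyer.BirchSwinnertonDyer.Theorems.SemiOrdinaryEisensteinDescentWildSplitEisensteinInclusionAtThreeStubSaturate
import Summits.BirchSwinnertonDyer.BirchSwinnertonDyer.Theorems.BiquadraticEisensteinDescentEisensteinDivisibilityCMInertBadFlatAtOneStubE2
import Summits.BirchSwinnertonDyer.BirchSwinnertonDyer.Theorems.SignedBaseChangeTwistPairGreenbergProductDivisibilitySplitBigImage
import Summits.BirchSwinnertonDyer.Rank1Residual.X11b.FrameLambdaUnit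
import Literature.NumberTheory.EllipticCurves.UnrIntegersUnits
import HarnessLib

/-!
# Crux E `WildSplitEisensteinInclusionAtThree` (stmt-BirchSwinnertonDyer-20479), line `birth`: the `μ`-HALF
# (`stub_frameMuZero`) FROM PRINT BY NAME, the frame-blindness of the crux, and the kernel identity
# «crux E = LEVER + Hsieh 2014 Thm. B» — HELPER (`--supports 20479`), lead prover bsd-wall-soed-p1 g0

Route `SemiOrdinaryEisensteinDescent` (SOED), cell `pub/bsd-wall`. Registered skeleton (sha16 4d547c0373835491,
`Cruxes/WildSplitEisensteinInclusionAtThree/Lines/birth.lean`): crux E ⟸ `stub_semiOrdinaryTransferUpToPPower`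
(THE LEVER: `∃ k, 3^k·Ch_Λ(X_(∅,0))·R₀⟦T⟧ ⊆ (L)`) + `stub_frameMuZero` (`μ(L) = 0`) + `stub_saturate` (LANDED,
p545527). THIS FILE proves, with NO new definition and NO new named fact:

* §1 **`stub_frameMuZero_of_thmB_anyLevel`** — the registered signature of `stub_frameMuZero` VERBATIM, with ONE
  hypothesis in front: the tree's refereed named fact
  `Hsieh2014.thmB_exists_isHsiehLFunction_coeff_norm_eq_one_unrPeriod_anyLevel` (Hsieh, Doc. Math. 19 (2014)
  Thm. B = Thm. 6.2, typed at every level). Proof (route-independent imports only, no `Theses` cone but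
  ours): `3 ∣ N` from `ClassO6` (additive at `3`); (Irr_K) — every framing of `E[3]|_{Γ_K}` absolutely
  irreducible — DISCHARGED from `ρ̄_{E,3}` onto and `[K:ℚ] = 2 < 3` (`SignedBaseChangeK1BigImage.irrM_framed_of_surj`);
  then route BED's chain (bed-p1 g2, `…FlatAtOneStubE2`): λ-supply ⟶ Hsieh witness with a norm-one coefficient
  ⟶ Castella ♭-frame with unit content (`exists_flatFrame_hasUnitContent_of_thmB_anyLevel`) ⟶ unit content of
  ANY `R₀`-frame by cross-period ideal rigidity (`hasUnitContent_map_of_isBDPLFunction_of_hasUnitContent`) ⟶ a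
  norm-one, i.e. unit (`unrIntegers.isUnit_iff_norm_eq_one`), coefficient of `L`. (Route UTD's
  `UniversalToricDescentSelfMuZero.self_forall_isBDPLFunction_coeff_norm_eq_one`, utd-p1 g4, is the same
  statement in norm-one form; it is not imported only to keep this file out of UTD's `Theses` cone.) So the
  `μ`-stub of line `birth` is PRINT BY NAME — exactly as the
  planner's two-layer plan said («the same input UTD's child 20400/20399 needs, so one proof serves both
  routes») — and is `stub-blocked` on that one EXISTING fact, nothing else.
* §2 **`conclusion_iff_of_frames`** / **`lever_iff_of_frames`** — the crux's conclusion `Ch·R₀⟦T⟧ ⊆ (L)` and the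
  lever's conclusion `∃ k, 3^k·Ch·R₀⟦T⟧ ⊆ (L)` DO NOT SEE THE FRAME: two `R₀`-frames `(Ω_K, Ω_p, L)`,
  `(Ω_K', Ω_p', L')` of the same `(ι', 𝔭, κ, γ, f)` with non-zero periods generate the same ideal
  (`X11b.R1.span_singleton_eq_of_isBDPLFunction`, odd `p`, `K` imaginary quadratic, `κ` anticyclotomic). Hence the
  ∀-frame typing of crux E costs exactly ONE frame per `(κ, γ, 𝔭, 𝔭', ι')`: **`conclusion_forall_frames_of_one`**.
* §3 **`conclusion_of_isUnit`** — the locus where crux E is FREE: if `L` is a unit of `R₀⟦T⟧` (unit constant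
  term, i.e. by cruxes V + C the corner `3 ∤ #Ш(E/K)·[E(K):ℤP]²/…`) the inclusion is automatic.
* §4 **`WildSplitEisensteinInclusionAtThree_of_lever_of_thmB`** — THE KERNEL IDENTITY OF THE LINE: crux E BY NAME
  from (i) the named fact of §1 and (ii) the LEVER displayed as a hypothesis (the registered signature of
  `stub_semiOrdinaryTransferUpToPPower` verbatim) — composition through the landed `stub_saturate`. It asserts
  nothing about the lever; it certifies that AFTER this file the open content of crux E is EXACTLY the lever
  (the Eisenstein inclusion after inverting `3` — no engine in print at a supercuspidal `π₃`: Wan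
  arXiv:1412.1767 Thm. 1.1 needs `π_p` good and `N` square-free) plus one refereed fact by name.

HONEST STATUS: crux E is NOT closed; nothing here is unconditional progress on the lever; BSD is not proved
for any curve by any of this. Supports, does not close, stmt-BirchSwinnertonDyer-20479.

References: [Hsieh2014] Thm. B (Doc. Math. 19 p. 712) = arXiv:1112.1580 Thm. 2; [Castella2018] Thm. 3.1
(arXiv:1704.06608 p. 9); [Wan2015Eisenstein] = arXiv:1412.1767 Thm. 1.1 (shape of the lever; good supersingular
`p`, square-free `N`); [Washington1997] §7.1.
-/

set_option autoImplicit false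
set_option linter.dupNamespace false -- `Summit.BirchSwinnertonDyer.BirchSwinnertonDyer.Theorems.…` (summit = sub)

noncomputable section

open scoped Classical

namespace Summit.BirchSwinnertonDyer.BirchSwinnertonDyer.Theorems.WildSplitEisensteinInclusionAtThreeMuHalfOfPrint

open PowerSeries NumberField IsDedekindDomain Field
  Literature.NumberTheory.EllipticCurves Literature.NumberTheory.GaloisRepresentations
  Summit.BirchSwinnertonDyer.Rank1Residual.X11b
  Summit.BirchSwinnertonDyer.BirchSwinnertonDyer.Theses.SemiOrdinaryEisensteinDescent
  Summit.BirchSwinnertonDyer.BirchSwinnertonDyer.Theorems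
  Summit.BirchSwinnertonDyer.BirchSwinnertonDyer.Theorems.WildSplitEisensteinInclusionAtThreeSaturate

/-! ### §1 The `μ`-half of line `birth` from Hsieh 2014 Thm. B at every level (by name) -/

/-- **`stub_frameMuZero` ⟸ Hsieh 2014 Thm. B (any level, BY NAME).** The registered signature of
`stub_frameMuZero` (skeleton sha16 4d547c0373835491) VERBATIM behind the one hypothesis `hB`: for `E` in the
cell and every `R₀`-frame `(Ω_K ≠ 0, Ω_p ≠ 0, L)` of `f_E` at `(ι', 𝔭, κ, γ)`, SOME coefficient of `L` is a unit
of `R₀` (`μ(L) = 0`). `3 ∣ N` (additive), (Irr_K) from onto (`irrM_framed_of_surj`), BED's ♭-frame with unit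
content from `hB` and its cross-period transport to the frame `L`, then norm one ⟹ unit in `R₀`
(`unrIntegers.isUnit_iff_norm_eq_one`). The torsion guard and the binders `r_an = 1`, `𝔭` of degree one, `𝔭'`
are idle. CONDITIONAL on the refereed fact `hB` only.
[cite: Hsieh2014, Thm. B p. 712 (Doc. Math. 19) = Thm. 2 (arXiv:1112.1580 p. 4 ll. 31–38)] -/
theorem stub_frameMuZero_of_thmB_anyLevel
    (hB : Hsieh2014.thmB_exists_isHsiehLFunction_coeff_norm_eq_one_unrPeriod_anyLevel) :
    ∀ (W : WeierstrassCurve ℚ) [W.IsElliptic] [W.IsGloballyMinimal] (N : ℕ) [NeZero N] (K : Type) [Field K] [NumberField K] (Dt : Literature.NumberTheory.EllipticCurves.ModularForms.ModularParametrizationData W N), Summit.BirchSwinnertonDyer.Rank1Residual.Additive.ClassO6 W 3 → W.HasSurjectiveModNGaloisRep 3 → W.analyticRank = 1 → W.conductorNorm ℤ = N → Literature.NumberTheory.EllipticCurves.IsImaginaryQuadratic K → Literature.NumberTheory.EllipticCurves.SatisfiesHeegnerHypothesis N K → ∀ (κ : Literature.NumberTheory.EllipticCurves.ZpExtension K 3),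 κ.IsAnticyclotomic → ∀ (γ : Field.absoluteGaloisGroup K) [Fact (κ.IsTopGenerator γ)] (𝔭 : IsDedekindDomain.HeightOneSpectrum (NumberField.RingOfIntegers K)), ((3 : ℕ) : NumberField.RingOfIntegers K) ∈ 𝔭.asIdeal → 𝔭.asIdeal.ramificationIdx (NumberField.RingOfIntegers ℚ) = 1 → 𝔭.asIdeal.inertiaDeg (NumberField.RingOfIntegers ℚ) = 1 → ∀ (𝔭' : IsDedekindDomain.HeightOneSpectrum (NumberField.RingOfIntegers K)), ((3 : ℕ) : NumberField.RingOfIntegers K) ∈ 𝔭'.asIdeal → 𝔭' ≠ 𝔭 → ∀ (ι' : PadicAlgCl 3 ≃+* ℂ), Summit.BirchSwinnertonDyer.BirchSwinnertonDyer.Theorems.SchneiderFree.BranchInducesPrime 3 ι' 𝔭 → ∀ (ΩK : ℂ) (Ωp : ℂ_[3]) (L : Literature.NumberTheory.EllipticCurves.UnrSeries 3), ΩK ≠ 0 → Ωp ≠ 0 → Literature.NumberTheory.EllipticCurves.IsBDPLFunction ι' 𝔭 κ γ Dt.f ΩK Ωp L → Module.IsTorsion (Literature.NumberTheory.EllipticCurves.IwasawaAlgebra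 3) (Summit.BirchSwinnertonDyer.Rank1Residual.X11b.AcSelmer.XAc (W.baseChange K) 3 κ 𝔭' ∅ γ) → ∃ n : ℕ, IsUnit (PowerSeries.coeff n L) := by
  intro W _ _ N _ K _ _ Dt hO6 hsurj _hr1 hN hK hH κ hκ γ _ 𝔭 h𝔭 _he _hf _𝔭' _h𝔭' _hne ι' hι ΩK Ωp L hΩK hΩp hL
    _htor
  have h32 : (3 : ℕ) ≠ 2 := by decide
  -- `3 ∣ N`: `E` is additive at `3`
  have hpN : 3 ∣ N := by
    rw [← hN]
    exact (W.dvd_conductorNorm_iff_not_hasGoodReductionAtPrime 3).mpr hO6.2.1.1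
  -- (Irr_K) from `ρ̄_{E,3}` onto and `[K:ℚ] = 2 < 3`
  have hIrr : ∀ ρ : ModPGaloisRep K (ZMod 3) 2, (W.baseChange K).IsTorsionGaloisRep 3 ρ →
      FramedRep.IsAbsolutelyIrreducible ρ := fun ρ hρ ↦
    SignedBaseChangeK1BigImage.irrM_framed_of_surj W 3 (by exact_mod_cast hsurj) K
      (by rw [hK.1]; norm_num) ρ hρ
  -- a ♭-frame with unit content (Hsieh Thm. B by name), transported to the given `R₀`-frame
  obtain ⟨ΩK₀, Ωp₀, Q, hΩK₀, hQ, hQc⟩ :=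
    BiquadraticEisensteinDescentEisensteinDivisibilityCMInertBadFlatAtOneStubE2.exists_flatFrame_hasUnitContent_of_thmB_anyLevel
      hB W h32 hpN Dt.isNewformOf hK hH h𝔭 hι hIrr hκ (Fact.out : κ.IsTopGenerator γ)
  obtain ⟨n, hn⟩ :=
    BiquadraticEisensteinDescentEisensteinDivisibilityCMInertBadFlatAtOneStubE2.exists_norm_coeff_eq_one_of_hasUnitContent_map
      (BiquadraticEisensteinDescentEisensteinDivisibilityCMInertBadFlatAtOneStubE2.hasUnitContent_map_of_isBDPLFunction_of_hasUnitContent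
        h32 hK hκ (Fact.out : κ.IsTopGenerator γ) hΩK₀ hΩK (coe_units_unrIntegers_ne_zero Ωp₀) hΩp hQ hQc hL)
  exact ⟨n, (unrIntegers.isUnit_iff_norm_eq_one _).mpr hn⟩

/-! ### §2 The crux and the lever do not see the frame -/

section Frames

variable {K : Type} [Field K] [NumberField K] {N : ℕ} {ι' : PadicAlgCl 3 ≃+* ℂ}
  {𝔭 : HeightOneSpectrum (𝓞 K)} {κ : ZpExtension K 3} {γ : Field.absoluteGaloisGroup K}
  {f : CuspForm (CongruenceSubgroup.Gamma0 N) 2} {ΩK ΩK' : ℂ} {Ωp Ωp' : ℂ_[3]} {L L' : UnrSeries 3}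

/-- **The crux's conclusion is frame-blind.** For two `R₀`-frames `(Ω_K, Ω_p, L)`, `(Ω_K', Ω_p', L')` of the same
`(ι', 𝔭, κ, γ, f)` at `p = 3` (`K` imaginary quadratic, `κ` anticyclotomic with topological generator `γ`,
non-zero periods) and ANY ideal `I` of `R₀⟦T⟧` (e.g. `I = Ch_Λ(X_(∅,0))·R₀⟦T⟧`): `I ≤ (L) ↔ I ≤ (L')`
(`X11b.R1.le_span_singleton_iff_of_isBDPLFunction`). [cite: Castella2018, Thm. 3.1 (arXiv:1704.06608 p. 9)] -/
theorem conclusion_iff_of_frames (hK : IsImaginaryQuadratic K) (hκ : κ.IsAnticyclotomic)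
    (hγ : κ.IsTopGenerator γ) (hΩK : ΩK ≠ 0) (hΩK' : ΩK' ≠ 0) (hΩp : Ωp ≠ 0) (hΩp' : Ωp' ≠ 0)
    (hL : IsBDPLFunction ι' 𝔭 κ γ f ΩK Ωp L) (hL' : IsBDPLFunction ι' 𝔭 κ γ f ΩK' Ωp' L')
    (I : Ideal (UnrSeries 3)) : I ≤ Ideal.span {L} ↔ I ≤ Ideal.span {L'} :=
  R1.le_span_singleton_iff_of_isBDPLFunction (p := 3) (by decide) hK hκ hγ hΩK hΩK' hΩp hΩp' hL hL' I

/-- **The lever's conclusion is frame-blind**: `(∃ k, ∀ x ∈ I, 3^k·x ∈ (L)) ↔ (∃ k, ∀ x ∈ I, 3^k·x ∈ (L'))`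
for two `R₀`-frames as in `conclusion_iff_of_frames` (the two frames generate the same ideal,
`X11b.R1.span_singleton_eq_of_isBDPLFunction`). [cite: Castella2018, Thm. 3.1 (arXiv:1704.06608 p. 9)] -/
theorem lever_iff_of_frames (hK : IsImaginaryQuadratic K) (hκ : κ.IsAnticyclotomic)
    (hγ : κ.IsTopGenerator γ) (hΩK : ΩK ≠ 0) (hΩK' : ΩK' ≠ 0) (hΩp : Ωp ≠ 0) (hΩp' : Ωp' ≠ 0)
    (hL : IsBDPLFunction ι' 𝔭 κ γ f ΩK Ωp L) (hL' : IsBDPLFunction ι' 𝔭 κ γ f ΩK' Ωp' L')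
    (I : Ideal (UnrSeries 3)) :
    (∃ k : ℕ, ∀ x ∈ I, (3 : UnrSeries 3) ^ k * x ∈ Ideal.span {L}) ↔
      (∃ k : ℕ, ∀ x ∈ I, (3 : UnrSeries 3) ^ k * x ∈ Ideal.span {L'}) := by
  rw [R1.span_singleton_eq_of_isBDPLFunction (p := 3) (by decide) hK hκ hγ hΩK hΩK' hΩp hΩp' hL hL']

/-- **∀-frame ⟸ ONE frame.** If the crux's inclusion `I ≤ (L₀)` holds at ONE `R₀`-frame `(Ω_K₀, Ω_p₀, L₀)` of
`(ι', 𝔭, κ, γ, f)` with non-zero periods, it holds at EVERY such frame: the ∀-frame typing of crux E costs one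
frame. [cite: Castella2018, Thm. 3.1 (arXiv:1704.06608 p. 9)] -/
theorem conclusion_forall_frames_of_one (hK : IsImaginaryQuadratic K) (hκ : κ.IsAnticyclotomic)
    (hγ : κ.IsTopGenerator γ) {ΩK₀ : ℂ} {Ωp₀ : ℂ_[3]} {L₀ : UnrSeries 3} (hΩK₀ : ΩK₀ ≠ 0) (hΩp₀ : Ωp₀ ≠ 0)
    (hL₀ : IsBDPLFunction ι' 𝔭 κ γ f ΩK₀ Ωp₀ L₀) (I : Ideal (UnrSeries 3)) (hI : I ≤ Ideal.span {L₀}) :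
    ∀ (ΩK : ℂ) (Ωp : ℂ_[3]) (L : UnrSeries 3), ΩK ≠ 0 → Ωp ≠ 0 → IsBDPLFunction ι' 𝔭 κ γ f ΩK Ωp L →
      I ≤ Ideal.span {L} :=
  fun _ΩK _Ωp _L hΩK hΩp hL ↦ (conclusion_iff_of_frames hK hκ hγ hΩK₀ hΩK hΩp₀ hΩp hL₀ hL I).mp hI

end Frames

/-! ### §3 The free locus: a unit `L` -/

/-- **Crux E is automatic where `L` is a unit of `R₀⟦T⟧`** (equivalently: its constant term `L(𝟙)` is a unit
of `R₀`; by cruxes V and C of the route this is the corner where `(log_ω P/c)²·(control count)` is a `3`-adic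
unit): then `(L) = R₀⟦T⟧` contains every ideal. [folklore] -/
theorem conclusion_of_isUnit {L : UnrSeries 3} (hL : IsUnit L) (I : Ideal (UnrSeries 3)) :
    I ≤ Ideal.span {L} := by
  rw [Ideal.span_singleton_eq_top.mpr hL]
  exact le_top

/-- The unit criterion in `R₀⟦T⟧`: `L` is a unit iff its constant term is a unit of `R₀` (Mathlib
`PowerSeries.isUnit_iff_constantCoeff`), recorded in the crux's vocabulary. [folklore] -/
theorem isUnit_iff_isUnit_constantCoeff (L : UnrSeries 3) :
    IsUnit L ↔ IsUnit (PowerSeries.constantCoeff L) :=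
  PowerSeries.isUnit_iff_constantCoeff

/-! ### §4 The kernel identity of line `birth`: crux E = LEVER + Hsieh Thm. B -/

/-- **Crux E BY NAME from the LEVER (displayed hypothesis) and Hsieh 2014 Thm. B (named fact).** `hLever` is the
registered signature of `stub_semiOrdinaryTransferUpToPPower` VERBATIM — the Eisenstein inclusion after inverting
`3`, the line's research content (NO engine in print at a supercuspidal `π₃`); `hB` is the refereed fact of §1.
Composition: `stub_saturate` (landed, p545527) ∘ (§1, `hLever`). This theorem ASSERTS NOTHING about the lever; it
certifies that the open content of crux E after this file is exactly `hLever` plus one fact by name.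
[cite: Hsieh2014, Thm. B p. 712 (Doc. Math. 19)] [cite: Castella2018, Thm. 3.1 (arXiv:1704.06608 p. 9)] -/
theorem WildSplitEisensteinInclusionAtThree_of_lever_of_thmB
    (hB : Hsieh2014.thmB_exists_isHsiehLFunction_coeff_norm_eq_one_unrPeriod_anyLevel)
    (hLever : ∀ (W : WeierstrassCurve ℚ) [W.IsElliptic] [W.IsGloballyMinimal] (N : ℕ) [NeZero N] (K : Type) [Field K] [NumberField K] (Dt : Literature.NumberTheory.EllipticCurves.ModularForms.ModularParametrizationData W N), Summit.BirchSwinnertonDyer.Rank1Residual.Additive.ClassO6 W 3 → W.HasSurjectiveModNGaloisRep 3 → W.analyticRank = 1 → W.conductorNorm ℤ = N → Literature.NumberTheory.EllipticCurves.IsImaginaryQuadratic K → Literature.NumberTheory.EllipticCurves.SatisfiesHeegnerHypothesis N K → ∀ (κ : Literature.NumberTheory.EllipticCurves.ZpExtension K 3), κ.IsAnticyclotomic → ∀ (γ : Field.absoluteGaloisGroup K) [Fact (κ.IsTopGenerator γ)] (𝔭 : IsDedekindDomain.HeightOneSpectrum (NumberField.RingOfIntegers K)), ((3 : ℕ) :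 NumberField.RingOfIntegers K) ∈ 𝔭.asIdeal → 𝔭.asIdeal.ramificationIdx (NumberField.RingOfIntegers ℚ) = 1 → 𝔭.asIdeal.inertiaDeg (NumberField.RingOfIntegers ℚ) = 1 → ∀ (𝔭' : IsDedekindDomain.HeightOneSpectrum (NumberField.RingOfIntegers K)), ((3 : ℕ) : NumberField.RingOfIntegers K) ∈ 𝔭'.asIdeal → 𝔭' ≠ 𝔭 → ∀ (ι' : PadicAlgCl 3 ≃+* ℂ), Summit.BirchSwinnertonDyer.BirchSwinnertonDyer.Theorems.SchneiderFree.BranchInducesPrime 3 ι' 𝔭 → ∀ (ΩK : ℂ) (Ωp : ℂ_[3]) (L : Literature.NumberTheory.EllipticCurves.UnrSeries 3), ΩK ≠ 0 → Ωp ≠ 0 → Literature.NumberTheory.EllipticCurves.IsBDPLFunction ι' 𝔭 κ γ Dt.f ΩK Ωp L → Module.IsTorsion (Literature.NumberTheory.EllipticCurves.IwasawaAlgebra 3) (Summit.BirchSwinnertonDyer.Rank1Residual.X11b.AcSelmer.XAc (W.baseChange K) 3 κ 𝔭' ∅ γ) → ∃ k : ℕ, ∀ x ∈ ((Summit.BirchSwinnertonDyer.Rank1Residual.X11b.AcSelmer.XAc.charIdeal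 (W.baseChange K) 3 κ 𝔭' ∅ γ).map (PowerSeries.map (Summit.BirchSwinnertonDyer.Rank1Residual.X11b.Halves.toUnr 3))), (3 : Literature.NumberTheory.EllipticCurves.UnrSeries 3) ^ k * x ∈ Ideal.span {L}) :
    WildSplitEisensteinInclusionAtThree := by
  intro W _ _ N _ K _ _ Dt hO6 hsurj hr1 hN hK hH κ hκ γ _ 𝔭 h𝔭 he hf 𝔭' h𝔭' hne ι' hι ΩK Ωp L hΩK hΩp hL htor
  exact stub_saturate _ L
    (stub_frameMuZero_of_thmB_anyLevel hB W N K Dt hO6 hsurj hr1 hN hK hH κ hκ γ 𝔭 h𝔭 he hf 𝔭' h𝔭' hne ι' hι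
      ΩK Ωp L hΩK hΩp hL htor)
    (hLever W N K Dt hO6 hsurj hr1 hN hK hH κ hκ γ 𝔭 h𝔭 he hf 𝔭' h𝔭' hne ι' hι ΩK Ωp L hΩK hΩp hL htor)

end Summit.BirchSwinnertonDyer.BirchSwinnertonDyer.Theorems.WildSplitEisensteinInclusionAtThreeMuHalfOfPrint

end
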